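import Mathlib
import Summits.KontsevichZagierPeriods.Zeta5Search.CatalanRemarksVTLagrange
import HarnessLib

/-!
# Zudilin 2002 [Zu02c], Theorem 2: the partial fractions of `R̃_n` (12) over `ℝ`, its derivative at the
# positive integers, and the digamma-type values `Σ_{ν≥1} (ν − P_k)⁻² = π² − (−1)^k·8G + κ(k)`

Source: W. Zudilin, *A few remarks on linear forms involving Catalan's constant*, arXiv:math/0210423
[Zudilin2002CatalanRemarks], Sect. 2, Theorem 2, eq. (12).  HONEST FRAMING (cell `pub-zeta5`): systematic search;
no irrationality claim unless certified — this file and its companion `CatalanRemarksTSeries` formalise the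
ANALYTIC clause (i) of the named fact `Zudilin2003.remarksTheorem2` (the series `ũ_n G − ṽ_n = −Σ_ν R̃_n′(ν)`);
nothing here is a statement about the arithmetic nature of Catalan's constant.

* `RT_eq_sum_resRT`: for `n ≥ 1` and real `t` off the nodes `ν_i = P_{i−n} = (2i−2n+1)/4` (`i < 2n+2`),
  `R̃_n(t) = Σ_{i<2n+2} resRT n (i−n)·(t − ν_i)⁻¹` — Lagrange interpolation of `Q̃_n = Ñ_n·(X − ν_{2n+1})` at the
  `2n+2` nodes over `ℝ` (Mathlib `Lagrange.eq_interpolate`), the base change `ℚ → ℝ` of the nodal weights and of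
  `Q̃_n(ν_i)`, and `resRT_eq_muRT_lagT` (file `CatalanRemarksVTLagrange`); the denominator of (12) is
  `2^{2n+1}·∏_{i<2n+1}(t − ν_i)` (`prod_den_RT`).
* `neg_deriv_RT`: `−R̃_n′(ν+1) = Σ_i resRT n (i−n)/((ν+1) − ν_i)²` (term-wise `HasDerivAt` on the open set off the
  nodes; a positive integer is never a quarter-odd node).
* `hasSum_tqTerm`: `Σ_{ν≥0} 16/(4ν+3−2k)² = π² − (−1)^k·8G + κ(k)` for every `k ∈ ℤ` (`tqTerm`, `tqVal`), from
  `ζ(2) = π²/6` (Mathlib `hasSum_zeta_two`: `Σ_{m≥0} 1/(2m+1)² = π²/8`, `hasSum_odd_sq`), `G = Σ(−1)^m/(2m+1)²` (the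
  tree's `catalanConstant`: `Σ 1/(4ν+1)² = π²/16 + G/2`, `Σ 1/(4ν+3)² = π²/16 − G/2`, `hasSum_quarter_sq`) and the
  two-sided induction `tqVal (k+2) = tqVal k + 16/(2k+1)²` (= the template's `kap_rec`).
-/

open Finset Filter Real Polynomial
open scoped Topology BigOperators

namespace Summit.KontsevichZagierPeriods.Zeta5Search.CatalanRemarksVT

open Literature.NumberTheory.Transcendental (catalanConstant hasSum_catalanConstant)
open Literature.NumberTheory.Irrationality.Zudilin2003
open Literature.NumberTheory.Irrationality.Zudilin2003.Remarks
open Literature.NumberTheory.Irrationality.KrattenthalerRivoal2008 (gbinom)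

/-! ### The digamma-type values `Σ_{ν≥1} (ν − P_k)⁻²` -/

/-- `Σ_{m≥0} 1/(2m+1)² = π²/8` (from `ζ(2) = π²/6`, Mathlib `hasSum_zeta_two`). [folklore] -/
private theorem hasSum_odd_sq : HasSum (fun m : ℕ => 1 / (2 * (m : ℝ) + 1) ^ 2) (π ^ 2 / 8) := by
  have h := hasSum_zeta_two
  have he : HasSum (fun k : ℕ => (1 : ℝ) / (((2 * k : ℕ) : ℝ)) ^ 2) (π ^ 2 / 24) := by
    have e1 : (fun k : ℕ => (1 : ℝ) / (((2 * k : ℕ) : ℝ)) ^ 2) = fun k : ℕ => 1 / 4 * (1 / (k : ℝ) ^ 2) := by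
      funext k; push_cast; ring
    rw [e1, show π ^ 2 / 24 = 1 / 4 * (π ^ 2 / 6) by ring]
    exact h.mul_left (1 / 4)
  have hs : Summable (fun k : ℕ => (1 : ℝ) / (((2 * k + 1 : ℕ) : ℝ)) ^ 2) :=
    h.summable.comp_injective (i := fun k : ℕ => 2 * k + 1) (fun a b hab => by simpa using hab)
  obtain ⟨b, hb⟩ := hs
  have htot := HasSum.even_add_odd (f := fun m : ℕ => (1 : ℝ) / (m : ℝ) ^ 2) he hb
  have hb' : b = π ^ 2 / 8 := by linarith [h.unique htot]
  have e2 : (fun m : ℕ => 1 / (2 * (m : ℝ) + 1) ^ 2) = fun k : ℕ => (1 : ℝ) / (((2 * k + 1 : ℕ) : ℝ)) ^ 2 := by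
    funext m; push_cast; ring
  rw [e2, ← hb']
  exact hb

/-- The two residue classes of odd squares: `Σ_{ν≥0} 1/(4ν+1)² = π²/16 + G/2`, `Σ_{ν≥0} 1/(4ν+3)² = π²/16 − G/2`
(`G = Σ (−1)^m/(2m+1)²` the tree's `catalanConstant`). [folklore] -/
private theorem hasSum_quarter_sq :
    HasSum (fun ν : ℕ => 1 / (4 * (ν : ℝ) + 1) ^ 2) (π ^ 2 / 16 + catalanConstant / 2) ∧
    HasSum (fun ν : ℕ => 1 / (4 * (ν : ℝ) + 3) ^ 2) (π ^ 2 / 16 - catalanConstant / 2) := by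
  set g : ℕ → ℝ := fun m => 1 / (2 * (m : ℝ) + 1) ^ 2 with hg
  have hgs : HasSum g (π ^ 2 / 8) := hasSum_odd_sq
  have hAs : Summable (fun ν : ℕ => g (2 * ν)) :=
    hgs.summable.comp_injective (i := fun ν : ℕ => 2 * ν) (fun a b hab => by simpa using hab)
  have hBs : Summable (fun ν : ℕ => g (2 * ν + 1)) :=
    hgs.summable.comp_injective (i := fun ν : ℕ => 2 * ν + 1) (fun a b hab => by simpa using hab)
  obtain ⟨A, hA⟩ := hAs
  obtain ⟨B, hB⟩ := hBs
  have h1 : A + B = π ^ 2 / 8 := (HasSum.even_add_odd hA hB).unique hgs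
  have hG : HasSum (fun m : ℕ => (-1 : ℝ) ^ m * g m) catalanConstant := by
    have e : (fun m : ℕ => (-1 : ℝ) ^ m * g m) = fun n : ℕ => (-1 : ℝ) ^ n / ((2 * n + 1 : ℝ)) ^ 2 := by
      funext m; simp only [hg]; ring
    rw [e]; exact hasSum_catalanConstant
  have hA' : HasSum (fun ν : ℕ => (-1 : ℝ) ^ (2 * ν) * g (2 * ν)) A := by
    have e : (fun ν : ℕ => (-1 : ℝ) ^ (2 * ν) * g (2 * ν)) = fun ν : ℕ => g (2 * ν) := by
      funext ν; rw [pow_mul]; norm_num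
    rw [e]; exact hA
  have hB' : HasSum (fun ν : ℕ => (-1 : ℝ) ^ (2 * ν + 1) * g (2 * ν + 1)) (-B) := by
    have e : (fun ν : ℕ => (-1 : ℝ) ^ (2 * ν + 1) * g (2 * ν + 1)) = fun ν : ℕ => -g (2 * ν + 1) := by
      funext ν; rw [pow_succ, pow_mul]; norm_num
    rw [e]; exact hB.neg
  have h2 : A + -B = catalanConstant :=
    (HasSum.even_add_odd (f := fun m : ℕ => (-1 : ℝ) ^ m * g m) hA' hB').unique hG
  have hAv : A = π ^ 2 / 16 + catalanConstant / 2 := by linarith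
  have hBv : B = π ^ 2 / 16 - catalanConstant / 2 := by linarith
  have eA : (fun ν : ℕ => 1 / (4 * (ν : ℝ) + 1) ^ 2) = fun ν : ℕ => g (2 * ν) := by
    funext ν; simp only [hg]; push_cast; ring_nf
  have eB : (fun ν : ℕ => 1 / (4 * (ν : ℝ) + 3) ^ 2) = fun ν : ℕ => g (2 * ν + 1) := by
    funext ν; simp only [hg]; push_cast; ring_nf
  rw [eA, eB, ← hAv, ← hBv]
  exact ⟨hA, hB⟩

/-- The term `16/(4ν+3−2k)² = (ν+1−P_k)⁻²` of the digamma-type sum over the lattice `ν ≥ 1` seen from the pole `P_k`.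
[cite: Zudilin2002CatalanRemarks, Sect. 2, eq. (12)] -/
noncomputable def tqTerm (k : ℤ) (ν : ℕ) : ℝ := 16 / (4 * (ν : ℝ) + 3 - 2 * (k : ℝ)) ^ 2

/-- The value `Σ_{ν≥1} (ν − P_k)⁻² = π² − (−1)^k·8G + κ(k)`. [cite: Zudilin2002CatalanRemarks, Sect. 1, eqs. (10)–(11)] -/
noncomputable def tqVal (k : ℤ) : ℝ := π ^ 2 - (-1 : ℝ) ^ k * (8 * catalanConstant) + ((kap k : ℚ) : ℝ)

/-- Shift by one lattice step: `tqTerm (k+2) (ν+1) = tqTerm k ν`. [folklore] -/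
theorem tqTerm_succ (k : ℤ) (ν : ℕ) : tqTerm (k + 2) (ν + 1) = tqTerm k ν := by
  unfold tqTerm; push_cast; ring_nf

/-- The new first term: `tqTerm (k+2) 0 = 16/(2k+1)²`. [folklore] -/
theorem tqTerm_zero (k : ℤ) : tqTerm (k + 2) 0 = 16 / (2 * (k : ℝ) + 1) ^ 2 := by
  unfold tqTerm; push_cast
  rw [show (4 * (0 : ℝ) + 3 - 2 * ((k : ℝ) + 2)) ^ 2 = (2 * (k : ℝ) + 1) ^ 2 by ring]

/-- `tqVal (k+2) = tqVal k + 16/(2k+1)²` (the recursion `κ(k+2) = κ(k) + 16/(2k+1)²`, `kap_rec`). [folklore] -/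
theorem tqVal_succ (k : ℤ) : tqVal (k + 2) = tqVal k + 16 / (2 * (k : ℝ) + 1) ^ 2 := by
  unfold tqVal
  rw [kap_rec, zpow_add₀ (by norm_num : (-1 : ℝ) ≠ 0)]
  push_cast
  norm_num
  ring

/-- The shift equivalence `HasSum (tqTerm k) (tqVal k) ↔ HasSum (tqTerm (k+2)) (tqVal (k+2))`. [folklore] -/
theorem hasSum_tqTerm_iff (k : ℤ) : HasSum (tqTerm k) (tqVal k) ↔ HasSum (tqTerm (k + 2)) (tqVal (k + 2)) := by
  have h := (hasSum_nat_add_iff (f := tqTerm (k + 2)) 1 (g := tqVal k))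
  simp only [sum_range_one, tqTerm_succ] at h
  rw [tqVal_succ, ← tqTerm_zero]
  exact h

/-- Base cases `k = 0, 1`: `Σ 16/(4ν+3)² = π² − 8G`, `Σ 16/(4ν+1)² = π² + 8G`. [folklore] -/
theorem hasSum_tqTerm_zero_one : HasSum (tqTerm 0) (tqVal 0) ∧ HasSum (tqTerm 1) (tqVal 1) := by
  obtain ⟨hA, hB⟩ := hasSum_quarter_sq
  have k0 : ((kap 0 : ℚ) : ℝ) = 0 := by norm_num [kap, kapPos]
  have k1 : ((kap 1 : ℚ) : ℝ) = 0 := by norm_num [kap, kapPos]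
  have e0 : tqTerm 0 = fun ν : ℕ => 16 * (1 / (4 * (ν : ℝ) + 3) ^ 2) := by
    funext ν; unfold tqTerm; push_cast; ring
  have e1 : tqTerm 1 = fun ν : ℕ => 16 * (1 / (4 * (ν : ℝ) + 1) ^ 2) := by
    funext ν; unfold tqTerm; push_cast; ring
  have v0 : tqVal 0 = 16 * (π ^ 2 / 16 - catalanConstant / 2) := by
    unfold tqVal; rw [k0]; norm_num; ring
  have v1 : tqVal 1 = 16 * (π ^ 2 / 16 + catalanConstant / 2) := by
    unfold tqVal; rw [k1]; norm_num; ring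
  rw [e0, e1, v0, v1]
  exact ⟨hB.mul_left 16, hA.mul_left 16⟩

/-- **`Σ_{ν≥0} 16/(4ν+3−2k)² = π² − (−1)^k·8G + κ(k)` for every `k ∈ ℤ`** (two-sided induction from `k = 0, 1`).
[cite: Zudilin2002CatalanRemarks, Sect. 1, eqs. (10)–(11)] -/
theorem hasSum_tqTerm (k : ℤ) : HasSum (tqTerm k) (tqVal k) := by
  have hpos : ∀ m : ℕ, HasSum (tqTerm m) (tqVal m) ∧ HasSum (tqTerm (m + 1)) (tqVal (m + 1)) := by
    intro m
    induction m with
    | zero => simpa using hasSum_tqTerm_zero_one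
    | succ m ih =>
      refine ⟨by exact_mod_cast ih.2, ?_⟩
      have h2 := (hasSum_tqTerm_iff (m : ℤ)).mp ih.1
      have e : ((m + 1 : ℕ) : ℤ) + 1 = (m : ℤ) + 2 := by push_cast; ring
      rw [e]; exact h2
  have hneg : ∀ m : ℕ, HasSum (tqTerm (-(m : ℤ))) (tqVal (-(m : ℤ))) ∧
      HasSum (tqTerm (-(m : ℤ) + 1)) (tqVal (-(m : ℤ) + 1)) := by
    intro m
    induction m with
    | zero => simpa using hasSum_tqTerm_zero_one
    | succ m ih =>
      refine ⟨?_, ?_⟩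
      · have := (hasSum_tqTerm_iff (-((m + 1 : ℕ) : ℤ))).mpr
        refine this ?_
        have e : -((m + 1 : ℕ) : ℤ) + 2 = -(m : ℤ) + 1 := by push_cast; ring
        rw [e]; exact ih.2
      · have e : -((m + 1 : ℕ) : ℤ) + 1 = -(m : ℤ) := by push_cast; ring
        rw [e]; exact ih.1
  obtain ⟨m, rfl | rfl⟩ := k.eq_nat_or_neg
  · exact (hpos m).1
  · exact (hneg m).1

/-! ### The partial fractions of (12) over `ℝ` and the derivative at the positive integers -/

/-- The denominator of (12) over `ℝ` is the nodal polynomial at the `2n+1` genuine poles: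
`∏_{j<2n+1} (2t + j − n − ½) = 2^{2n+1}·∏_{i<2n+1} (t − ν_i)`. [cite: Zudilin2002CatalanRemarks, Sect. 2, eq. (12)] -/
theorem prod_den_RT (n : ℕ) (t : ℝ) :
    ∏ j ∈ range (2 * n + 1), (2 * t + j - n - 1 / 2) = 2 ^ (2 * n + 1) * ∏ i ∈ range (2 * n + 1), (t - (node n i : ℝ)) := by
  rw [← Finset.prod_range_reflect (fun i => t - (node n i : ℝ)) (2 * n + 1),
    show (2 : ℝ) ^ (2 * n + 1) = ∏ _j ∈ range (2 * n + 1), (2 : ℝ) by simp, ← Finset.prod_mul_distrib]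
  refine Finset.prod_congr rfl fun j hj => ?_
  rw [mem_range] at hj
  rw [show 2 * n + 1 - 1 - j = 2 * n - j by omega]
  unfold node
  rw [Nat.cast_sub (by omega)]
  push_cast
  ring

/-- The numerator polynomial `Q̃_n` base-changed to `ℝ` evaluates to `Ñ_n(t)·(t − ν_{2n+1})`.
[cite: Zudilin2002CatalanRemarks, Sect. 2, eq. (12)] -/
theorem eval_map_QpolT (n : ℕ) (t : ℝ) :
    ((QpolT n).map (algebraMap ℚ ℝ)).eval t =
      (∏ j ∈ range (n - 1), (t - ((j : ℝ) + 1))) * (∏ j ∈ range n, (t - ((j : ℝ) + 1)))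
        * (t - (node n (2 * n + 1) : ℝ)) := by
  simp [QpolT, numPT, Polynomial.map_mul, Polynomial.map_prod, Polynomial.eval_mul, Polynomial.eval_prod]

/-- Evaluating the base change at a rational point. [folklore] -/
private theorem eval_map_ratCast (p : ℚ[X]) (q : ℚ) : (p.map (algebraMap ℚ ℝ)).eval (q : ℝ) = ((p.eval q : ℚ) : ℝ) := by
  rw [Polynomial.eval_map, show (q : ℝ) = algebraMap ℚ ℝ q from rfl, Polynomial.eval₂_hom]
  rfl

/-- The nodal weights commute with the base change `ℚ → ℝ`. [folklore] -/
private theorem nodalWeight_ratCast (n i : ℕ) :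
    Lagrange.nodalWeight (range (2 * n + 2)) (fun j => (node n j : ℝ)) i =
      ((Lagrange.nodalWeight (range (2 * n + 2)) (node n) i : ℚ) : ℝ) := by
  simp only [Lagrange.nodalWeight]
  push_cast
  rfl

/-- **The partial-fraction decomposition of (12) over `ℝ`**: for `n ≥ 1` and real `t` off the `2n+2` nodes,
`R̃_n(t) = Σ_{i<2n+2} resRT n (i−n)·(t − ν_i)⁻¹` (the top node carries residue `0`).
[cite: Zudilin2002CatalanRemarks, Sect. 2, eq. (12)] -/
theorem RT_eq_sum_resRT (n : ℕ) (hn : 1 ≤ n) (t : ℝ) (ht : ∀ i ∈ range (2 * n + 2), t ≠ (node n i : ℝ)) :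
    RT n t = ∑ i ∈ range (2 * n + 2), ((resRT n ((i : ℤ) - n) : ℚ) : ℝ) * (t - (node n i : ℝ))⁻¹ := by
  classical
  set v : ℕ → ℝ := fun i => (node n i : ℝ) with hv
  set Q : ℝ[X] := (QpolT n).map (algebraMap ℚ ℝ) with hQ
  have hinj : Set.InjOn v ↑(range (2 * n + 2)) := by
    intro a ha b hb hab
    exact node_injOn n ha hb (by simpa [hv] using hab)
  have hdeg : Q.degree < ((range (2 * n + 2)).card : WithBot ℕ) := by
    rw [card_range]
    refine (Polynomial.degree_map_le).trans_lt ?_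
    exact (Polynomial.degree_le_of_natDegree_le (natDegree_QpolT_le n hn)).trans_lt
      (by exact_mod_cast (show 2 * n < 2 * n + 2 by omega))
  have hL := Lagrange.eq_interpolate (s := range (2 * n + 2)) (v := v) (f := Q) hinj hdeg
  have hev : Q.eval t = (∏ i ∈ range (2 * n + 2), (t - v i)) *
      ∑ i ∈ range (2 * n + 2), Lagrange.nodalWeight (range (2 * n + 2)) v i * (t - v i)⁻¹ * Q.eval (v i) := by
    conv_lhs => rw [hL]
    rw [Lagrange.eval_interpolate_not_at_node _ ht, Lagrange.eval_nodal]
  have hP1 : ∏ i ∈ range (2 * n + 1), (t - v i) ≠ 0 :=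
    Finset.prod_ne_zero_iff.mpr fun i hi => sub_ne_zero.mpr (ht i (by rw [mem_range] at hi ⊢; omega))
  have htop : t - v (2 * n + 1) ≠ 0 := sub_ne_zero.mpr (ht _ (by simp))
  have hP2 : ∏ i ∈ range (2 * n + 2), (t - v i) ≠ 0 := by
    rw [Finset.prod_range_succ]; exact mul_ne_zero hP1 htop
  have hsum : ∑ i ∈ range (2 * n + 2), ((resRT n ((i : ℤ) - n) : ℚ) : ℝ) * (t - v i)⁻¹
      = (muRT n : ℝ) * ∑ i ∈ range (2 * n + 2),
          Lagrange.nodalWeight (range (2 * n + 2)) v i * (t - v i)⁻¹ * Q.eval (v i) := by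
    rw [Finset.mul_sum]
    refine Finset.sum_congr rfl fun i hi => ?_
    rw [mem_range] at hi
    rw [resRT_eq_muRT_lagT n i hn hi, hQ, hv, eval_map_ratCast, nodalWeight_ratCast]
    push_cast [lagT]
    ring
  have hS : ∑ i ∈ range (2 * n + 2), Lagrange.nodalWeight (range (2 * n + 2)) v i * (t - v i)⁻¹ * Q.eval (v i)
      = Q.eval t / ∏ i ∈ range (2 * n + 2), (t - v i) := by
    rw [hev, mul_div_cancel_left₀ _ hP2]
  rw [hsum, hS, Finset.prod_range_succ, hQ, eval_map_QpolT]
  simp only [hv] at hP1 htop ⊢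
  unfold RT
  rw [prod_den_RT]
  unfold muRT
  push_cast
  have h2 : (2 : ℝ) ^ (2 * n + 1) ≠ 0 := pow_ne_zero _ two_ne_zero
  have hf : (((n - 1).factorial : ℕ) : ℝ) ≠ 0 := by positivity
  field_simp
  ring

/-- The open set off the nodes. [folklore] -/
theorem isOpen_offNodes (n : ℕ) : IsOpen {t : ℝ | ∀ i ∈ range (2 * n + 2), t ≠ (node n i : ℝ)} := by
  have : {t : ℝ | ∀ i ∈ range (2 * n + 2), t ≠ (node n i : ℝ)} = ⋂ i ∈ range (2 * n + 2), {t | t ≠ (node n i : ℝ)} := by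
    ext t; simp
  rw [this]
  exact isOpen_biInter_finset fun i _ => isOpen_ne

/-- A positive integer is never a node `(2i−2n+1)/4`. [folklore] -/
theorem natCast_succ_ne_node (n ν i : ℕ) : (ν : ℝ) + 1 ≠ (node n i : ℝ) := by
  intro h
  unfold node at h
  have h' : ((4 * ((ν : ℤ) + 1) : ℤ) : ℝ) = ((2 * (i : ℤ) - 2 * n + 1 : ℤ) : ℝ) := by push_cast; push_cast at h; linarith
  have h'' : (4 * ((ν : ℤ) + 1) : ℤ) = 2 * (i : ℤ) - 2 * n + 1 := by exact_mod_cast h'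
  omega

/-- **The derivative of (12) at the positive integers**: `−R̃_n′(ν+1) = Σ_{i<2n+2} resRT n (i−n)/((ν+1) − ν_i)²`.
[cite: Zudilin2002CatalanRemarks, Sect. 2, eq. (12)] -/
theorem neg_deriv_RT (n : ℕ) (hn : 1 ≤ n) (ν : ℕ) :
    -deriv (fun t : ℝ => RT n t) ((ν : ℝ) + 1) =
      ∑ i ∈ range (2 * n + 2), ((resRT n ((i : ℤ) - n) : ℚ) : ℝ) / ((ν : ℝ) + 1 - (node n i : ℝ)) ^ 2 := by
  set x : ℝ := (ν : ℝ) + 1 with hx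
  have hxU : ∀ i ∈ range (2 * n + 2), x ≠ (node n i : ℝ) := fun i _ => natCast_succ_ne_node n ν i
  have hD : HasDerivAt (fun t : ℝ => ∑ i ∈ range (2 * n + 2), ((resRT n ((i : ℤ) - n) : ℚ) : ℝ) * (t - (node n i : ℝ))⁻¹)
      (∑ i ∈ range (2 * n + 2), ((resRT n ((i : ℤ) - n) : ℚ) : ℝ) * (-(1 : ℝ) / (x - (node n i : ℝ)) ^ 2)) x := by
    refine HasDerivAt.fun_sum fun i hi => ?_
    refine HasDerivAt.const_mul _ ?_
    exact ((hasDerivAt_id x).sub_const _).inv (sub_ne_zero.mpr (hxU i hi))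
  have hEq : (fun t : ℝ => RT n t) =ᶠ[𝓝 x]
      fun t : ℝ => ∑ i ∈ range (2 * n + 2), ((resRT n ((i : ℤ) - n) : ℚ) : ℝ) * (t - (node n i : ℝ))⁻¹ := by
    filter_upwards [(isOpen_offNodes n).mem_nhds hxU] with t ht
    exact RT_eq_sum_resRT n hn t ht
  rw [(hEq.hasDerivAt_iff.mpr hD).deriv, ← Finset.sum_neg_distrib]
  refine Finset.sum_congr rfl fun i _ => ?_
  ring

end Summit.KontsevichZagierPeriods.Zeta5Search.CatalanRemarksVT
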